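import Summits.ABC.IUTFork.ForkGenuineWindowSharpCond
import Summits.ABC.IUTFork.Conditional.AbcOfSHvolGenuineFamily
import Literature.IUT.LogVolume.GenuineLogThetaPointDegrees
import HarnessLib

/-!
# Branch C, TARGET #1 (`hvol` / `hreg`): the SHARP split-pair inequality at the `λ`-line — abc-iut-S4's log-different
# slack transported to the presenting field (sharp twins of abc-iut-s2-p5's `splitPair_le_of_hullVolumeAtDatum` and
# abc-iut-s2-p3's `splitDepth_le_of_hullVolumeAtDatum`)

Record-only PROOF file (D-0012) of the abc-iut cell (branch C certificate seat abc-iut-C-cert-1, gen 3, unit «HVOL-KERNEL»);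
TAKES NO SIDE on [IUTchIII] Cor. 3.12 or [IUTchIV] Thm. 1.10. S. Mochizuki, *IUT IV* [Mochizuki2012], Thm. 1.10 proof
Step (ii) p. 24 (first display `log(𝔡^{F_tpd}) + log(𝔣^{F_tpd}) ≤ log(𝔡^F) + log(𝔣^F)`), Step (v) pp. 27–28 (the symmetrisation
in `i† ∈ I`); Cor. 2.2 (ii) proof p. 46 ((P5)); Dupuy–Hilado [DupuyHilado2025] §3.3, §3.6, §4.7, §4.12.

CONTEXT. The CONE binder of `Conditional.abc_of_S_v3` (p430884) is
`hvol : ∀ P ∈ UP, ∀ l prime ≥ 5, AdmitsCore → CondP2 → CondP5 → CondP6 → Cor22.HullVolumeAtDatum P l B_III(P,l)`; the CONE binder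
`hreg` of v4/v6K/v10M/v8K-window/v11M-window/p443000 implies it (`ThetaPartII.hullVolume_of_hullRegime`, abc-iut-c312-8/S3/S1).
abc-iut-s2-p5 (`splitPair_le_of_hullVolumeAtDatum`, p435094) and abc-iut-s2-p3 (`splitDepth_le_of_hullVolumeAtDatum`, p438255) read
`Cor22.HullVolumeAtDatum P l δ` at a quadratic point with a split prime `p = VW`, `V` a pole of `j(λ)` of order `≥ 2M`, `W` not a pole,
as `(l+1)·M·log p/48 ≤ δ`. abc-iut-S4 (`PointDict.pair_le_slack_of_hullVolumeAtDatum`, p445514, with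
`Cor22.ThetaVolumeDatumAt.ndeg_differentDivisor_ge`: `log(𝔡^K) ≥ log-diff(λ) + (1 − 1/l)·log 𝔣^{F_tpd}_{∤2l}`) sharpened the
datum-level bound by the log-different gain: pair `≤ δ − ((ℓ⋇+3)/2 − [F_mod:ℚ])·(log-diff + (1 − 1/l)·log-cond)`. THIS FILE
transports S4's sharp bound to the presenting field exactly along s2-p5's / s2-p3's route (same transport lemmas, BY NAME):

* `PointDict.ordPair_le_slack_of_hullVolumeAtDatum` — S4's sharp pair bound in the `q`-ORDER currency of abc-iut-S7's
  `PointDict.mu_eq` (`μ_T(u) = (−ord_u j_E)/(2l)·ln N(u)/n_u` on `𝕍^bad_mod`, `0` off it), with `(ℓ⋇+3)/2 = (l+5)/4` and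
  `[F_mod:ℚ] = d_mod` substituted (abc-iut-L5-t3's `finrank_rat_fieldOfModuli_eq_dmod`);
* `PointDict.splitPair_le_slack_of_hullVolumeAtDatum` — the same read on `F_mod = ℚ(j(λ)) ⊆ F_tpd` (s2-p5's transport verbatim);
* `PointDict.splitPairPt_le_slack_of_hullVolumeAtDatum` — on the presenting field when `ℚ(j(λ)) = F_tpd` (s2-p3's transport verbatim);
* **`PointDict.splitDepth_le_slack_of_hullVolumeAtDatum`** — at a quadratic point of split depth `≥ 2M` over the odd prime `p`
  (`Pr(V) = Pr(W) = 1/2`, `n_V = 1`, `log N(V) = log p`, `d_mod = 2`):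
  `(l+1)·M·log p/48 ≤ δ − ((l+5)/4 − 2)·(log-diff(λ) + (1 − 1/l)·log 𝔣^{F_tpd}_{∤2l}(λ))`.

READING. With `δ = B_III(P,l) = (l+1)/4·{(1+24/l)(lD+lC) + E(l)}` the right side is `≤ 8·(lD+lC) + (l+1)/4·E(l)` (`l ≥ 11`): the
conductor enters with a BOUNDED coefficient instead of `(l+1)/4` — the input of this seat's `Conditional/NotHvol.lean`. HONEST SCOPE:
consequences of the typed (U)-computable half at genuine data; nothing asserted about any point; no side taken on Cor. 3.12 /
Thm. 1.10 or on any author; typed ≠ proved. PROOF-ONLY file: no definitions, no named `Prop` facts.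
[cite: Mochizuki2012, IUTchIV Thm. 1.10 Step (ii) p. 24, Step (v) p. 27–28] [cite: Mochizuki2012, IUTchIV Cor. 2.2 (ii) proof p. 46]
[cite: DupuyHilado2025, §3.3, §3.6, §4.7, §4.12] [cite: NeukirchANT1999, Ch. I §8 Prop. (8.2)] [claim: Mochizuki2012, status: disputed]
for every IUT quotation.
-/

noncomputable section

namespace Summit.ABC.IUTFork

open NumberField IsDedekindDomain Literature.IUT.LogVolume Literature.IUT.HodgeTheaters
open Literature.NumberTheory.DiophantineGeometry.GenEll
open scoped Classical

namespace PointDict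

variable {P : NFPoint} {l : ℕ}

/-- **The SHARP pair bound in the `q`-order currency.** `Cor22.HullVolumeAtDatum P l δ` forces, at every genuine Θ-volume datum `T`
of `(P, l)` with `4·d_mod ≤ l + 5`, every bad place `v ∈ 𝕍^bad_mod` of `F_mod = ℚ(j_E)` and every place `w ∉ 𝕍^bad_mod` over the
same rational prime: `Pr(v)·Pr(w)·(l(l+1)/12)·((−ord_v j_E)/(2l))·ln N(v)/n_v ≤ δ − ((l+5)/4 − d_mod)·(log-diff(λ) + (1 − 1/l)·log 𝔣^{F_tpd})`
(abc-iut-S4's `pair_le_slack_of_hullVolumeAtDatum`, abc-iut-S7's `mu_eq` / `avgSq_eq`, `[F_mod:ℚ] = d_mod`, `ℓ⋇ = (l−1)/2`).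
Nothing asserted about any point; no side taken. [cite: Mochizuki2012, IUTchIV Thm. 1.10 Step (ii) p. 24, Step (v) p. 27–28]
[cite: DupuyHilado2025, §3.3, §3.6, §4.7, §4.12] [claim: Mochizuki2012, status: disputed] -/
theorem ordPair_le_slack_of_hullVolumeAtDatum {δ : ℝ} (h : Cor22.HullVolumeAtDatum P l δ) (hl : 0 < l)
    (T : Cor22.ThetaVolumeDatumAt P l) (hd4 : 4 * (Cor22.dmod P : ℝ) ≤ (l : ℝ) + 5) :
    (letI := T.instFieldF; letI := T.instNumberFieldF; letI := T.instAlgebraF; letI := T.instFieldK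
     letI := T.instNumberFieldK; letI := T.instAlgebraK; letI := T.instFieldFbar; letI := T.instAlgebraFbar
     letI := T.instAlgebraKFbar; letI := T.instIsElliptic
     ∀ (p : ℕ) [Fact p.Prime] (v w : placesOver (fieldOfModuli T.E) p),
       v.1 ∈ ThetaData.badPrimesMod T.D → w.1 ∉ ThetaData.badPrimesMod T.D →
       weight (fieldOfModuli T.E) v.1 * weight (fieldOfModuli T.E) w.1 * ((l : ℝ) * ((l : ℝ) + 1) / 12) *
         (((-ord (fieldOfModuli T.E) v.1 (ThetaData.jMod T.E) : ℤ) : ℝ) / (2 * (l : ℝ)) *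
           logNorm (fieldOfModuli T.E) v.1 / (localDegree (fieldOfModuli T.E) v.1 : ℝ)) ≤
         δ - (((l : ℝ) + 5) / 4 - (Cor22.dmod P : ℝ)) * (P.logDiff + (1 - 1 / (l : ℝ)) * Cor22.logCondAvoid P {2, l})) := by
  letI := T.instFieldF; letI := T.instNumberFieldF; letI := T.instAlgebraF; letI := T.instFieldK
  letI := T.instNumberFieldK; letI := T.instAlgebraK; letI := T.instFieldFbar; letI := T.instAlgebraFbar
  letI := T.instAlgebraKFbar; letI := T.instIsElliptic
  intro p _ v w hv hw
  -- the datum's invariants are functions of `(P, l)`: `[F_mod:ℚ] = d_mod`, `l = 2ℓ⋇ + 1`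
  have hfin : (Module.finrank ℚ (fieldOfModuli T.E) : ℝ) = (Cor22.dmod P : ℝ) := by
    exact_mod_cast T.finrank_rat_fieldOfModuli_eq_dmod
  have hlc : (T.I.X.l : ℝ) = 2 * T.I.X.lstar + 1 := T.I.X.l_cast
  have hXl : T.I.X.l = l := (X_S_eq T).2.2
  rw [hXl] at hlc
  have hd : (Module.finrank ℚ (fieldOfModuli T.E) : ℝ) ≤ ((T.I.X.lstar : ℝ) + 3) / 2 := by
    rw [hfin]; linarith
  -- `p` is a support prime (it lies under the bad place `v`)
  have hp : p ∈ T.I.supportPrimes := by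
    have h1 := residueChar_mem_supportPrimes_of_bad T v.1 hv
    rwa [(mem_placesOver_iff_residueChar v.1).mp v.2] at h1
  have hpair := pair_le_slack_of_hullVolumeAtDatum h hl T hd p hp v w
  have hμv := mu_eq T v.1
  have hμw := mu_eq T w.1
  rw [if_pos hv] at hμv
  rw [if_neg hw] at hμw
  have e1 : ((T.I.X.lstar : ℝ) + 1) * (2 * T.I.X.lstar + 1) / 6 = (l : ℝ) * ((l : ℝ) + 1) / 12 := avgSq_eq T
  have e2 : ((T.I.X.lstar : ℝ) + 3) / 2 - (Module.finrank ℚ (fieldOfModuli T.E) : ℝ) =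
      ((l : ℝ) + 5) / 4 - (Cor22.dmod P : ℝ) := by
    rw [hfin]; linarith
  change weight (fieldOfModuli T.E) v.1 * weight (fieldOfModuli T.E) w.1 *
      (((T.I.X.lstar : ℝ) + 1) * (2 * T.I.X.lstar + 1) / 6) *
      (T.I.X.qPilot v.1 * logNorm (fieldOfModuli T.E) v.1 / (localDegree (fieldOfModuli T.E) v.1 : ℝ)
        - T.I.X.qPilot w.1 * logNorm (fieldOfModuli T.E) w.1 / (localDegree (fieldOfModuli T.E) w.1 : ℝ)) ≤
      δ - (((T.I.X.lstar : ℝ) + 3) / 2 - (Module.finrank ℚ (fieldOfModuli T.E) : ℝ)) *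
        (P.logDiff + (1 - 1 / (l : ℝ)) * Cor22.logCondAvoid P {2, l}) at hpair
  rw [hμv, hμw, sub_zero, e1, e2] at hpair
  exact hpair

/-- **The SHARP split-pair inequality on `j(λ)` — datum-free, IUT-free statement** (sharp twin of abc-iut-s2-p5's
`splitPair_le_of_hullVolumeAtDatum`). `F_mod := ℚ(j(λ)) ⊆ F_tpd`; `v, w` places of `F_mod` over the rational prime `p` with
`ord_v j(λ) < 0`, `v ∤ 2`, `v ∤ l` and `ord_w j(λ) ≥ 0` or `w | 2` or `w | l`. IF `Cor22.HullVolumeAtDatum P l δ`, `4·d_mod ≤ l + 5`,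
and a genuine Θ-volume datum `T` exists at `(P, l)`, THEN
`Pr(v)·Pr(w)·(l(l+1)/12)·((−ord_v j(λ))/(2l))·log N(v)/n_v ≤ δ − ((l+5)/4 − d_mod)·(log-diff(λ) + (1 − 1/l)·log 𝔣^{F_tpd}_{∤2l})`.
PROOF: `ordPair_le_slack_of_hullVolumeAtDatum` on the datum's `F_mod(E_F) ⊆ F`, transported along abc-iut-s2-p5's
`range_algebraMap_adjoin_jInv_eq` (same image ⟹ same places, weights, normalised local heights), with badness read through the
(P5) choice `T.isP5Choice` — s2-p5's transport verbatim. Nothing asserted about any point; no side taken on [IUTchIII] Cor. 3.12.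
[cite: Mochizuki2012, IUTchIV Thm. 1.10 Step (ii) p. 24, Step (v) p. 27–28] [cite: Mochizuki2012, IUTchIV Cor. 2.2 (ii) proof p. 46]
[cite: DupuyHilado2025, §3.3, §3.6, §4.7, §4.12] [claim: Mochizuki2012, status: disputed] -/
theorem splitPair_le_slack_of_hullVolumeAtDatum {δ : ℝ} (h : Cor22.HullVolumeAtDatum P l δ) (hl : 0 < l)
    (T : Cor22.ThetaVolumeDatumAt P l) (hd4 : 4 * (Cor22.dmod P : ℝ) ≤ (l : ℝ) + 5) (p : ℕ) [Fact p.Prime]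
    (v w : HeightOneSpectrum (𝓞 ↥(IntermediateField.adjoin ℚ ({Cor22.jInv P.x} : Set P.F))))
    (hv : v ∈ placesOver _ p) (hw : w ∈ placesOver _ p) (hvj : ord _ v (Cor22.jMod P) < 0)
    (hv2 : ((2 : ℕ) : 𝓞 _) ∉ v.asIdeal) (hvl : ((l : ℕ) : 𝓞 _) ∉ v.asIdeal)
    (hwj : 0 ≤ ord _ w (Cor22.jMod P) ∨ ((2 : ℕ) : 𝓞 _) ∈ w.asIdeal ∨ ((l : ℕ) : 𝓞 _) ∈ w.asIdeal) :
    weight _ v * weight _ w * ((l : ℝ) * ((l : ℝ) + 1) / 12) *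
      (((-ord _ v (Cor22.jMod P) : ℤ) : ℝ) / (2 * (l : ℝ)) * logNorm _ v / (localDegree _ v : ℝ)) ≤
      δ - (((l : ℝ) + 5) / 4 - (Cor22.dmod P : ℝ)) * (P.logDiff + (1 - 1 / (l : ℝ)) * Cor22.logCondAvoid P {2, l}) := by
  -- adapted from abc-iut-s2-p5's `splitPair_le_of_hullVolumeAtDatum` (Conditional/AbcOfSHvolSplitHeight.lean): same transport,
  -- sharp core `ordPair_le_slack_of_hullVolumeAtDatum` instead of abc-iut-S7's `ordPair_le_of_hullVolumeAtDatum`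
  letI := T.instFieldF; letI := T.instNumberFieldF; letI := T.instAlgebraF; letI := T.instFieldK
  letI := T.instNumberFieldK; letI := T.instAlgebraK; letI := T.instFieldFbar; letI := T.instAlgebraFbar
  letI := T.instAlgebraKFbar; letI := T.instIsElliptic
  -- the two copies of `F_mod` inside `F`
  set Fm : Type := ↥(IntermediateField.adjoin ℚ ({Cor22.jInv P.x} : Set P.F)) with hFm
  letI : Algebra Fm T.F := ((algebraMap P.F T.F).comp (algebraMap Fm P.F)).toAlgebra
  have hrange : Set.range (algebraMap Fm T.F) = Set.range (algebraMap ↥(fieldOfModuli T.E) T.F) :=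
    range_algebraMap_adjoin_jInv_eq T
  have hjj : algebraMap Fm T.F (Cor22.jMod P) = algebraMap ↥(fieldOfModuli T.E) T.F (ThetaData.jMod T.E) := by
    change algebraMap P.F T.F (algebraMap Fm P.F (Cor22.jMod P)) = T.E.j
    rw [T.j_eq]
    rfl
  -- places `x | v`, `y | w` of `F` and their restrictions `v', w'` to `F_mod(E_F)`
  obtain ⟨x, hx⟩ := PlaceSection.exists_under_eq (F₀ := Fm) (K := T.F) v
  obtain ⟨y, hy⟩ := PlaceSection.exists_under_eq (F₀ := Fm) (K := T.F) w
  have hxv : finBelow Fm T.F x = v := HeightOneSpectrum.ext (by rw [← hx]; rfl)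
  have hyw : finBelow Fm T.F y = w := HeightOneSpectrum.ext (by rw [← hy]; rfl)
  have hxp : x ∈ placesOver T.F p := by
    rw [mem_placesOver_iff_residueChar] at hv ⊢
    rw [← residueChar_finBelow (F := Fm), hxv, hv]
  have hyp : y ∈ placesOver T.F p := by
    rw [mem_placesOver_iff_residueChar] at hw ⊢
    rw [← residueChar_finBelow (F := Fm), hyw, hw]
  set v' := finBelow ↥(fieldOfModuli T.E) T.F x with hv'
  set w' := finBelow ↥(fieldOfModuli T.E) T.F y with hw'
  have hv'p : v' ∈ placesOver ↥(fieldOfModuli T.E) p := finBelow_mem_placesOver _ T.F hxp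
  have hw'p : w' ∈ placesOver ↥(fieldOfModuli T.E) p := finBelow_mem_placesOver _ T.F hyp
  -- `v'` is a (P5)-bad prime of `F_mod(E_F)`: `x ∤ 2l` and `E_F` is multiplicative at `x` (semistable, `ord_x j < 0`)
  have hordx : ord T.F x T.E.j < 0 := by
    have h1 : ord Fm (finBelow Fm T.F x) (Cor22.jMod P) < 0 := by rw [hxv]; exact hvj
    rw [← Cor22.ord_algebraMap_neg_iff x (Cor22.jMod P), hjj] at h1
    exact h1
  have hmult : T.E.HasMultiplicativeReductionAt x := by
    refine (T.D.isSemistable x).resolve_left fun hgood => ?_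
    have hle : x.valuation T.F T.E.j ≤ 1 := valuation_j_le_one_of_hasGoodReduction_localMinimalModel x T.E hgood
    have h0 : 0 ≤ ord T.F x T.E.j := by
      unfold ord
      rw [neg_nonneg]
      by_cases hz : x.valuation T.F T.E.j = 0
      · simp [hz]
      · rw [← WithZero.log_one]
        exact (WithZero.log_le_log hz one_ne_zero).mpr hle
    omega
  have hx2l : ∀ q ∈ ({2, l} : Finset ℕ), ((q : ℕ) : 𝓞 T.F) ∉ x.asIdeal := by
    intro q hq hmem
    have hmem' : ((q : ℕ) : 𝓞 Fm) ∈ (finBelow Fm T.F x).asIdeal :=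
      (Cor22.natCast_mem_asIdeal_finBelow_iff x q).mpr hmem
    rw [hxv] at hmem'
    simp only [Finset.mem_insert, Finset.mem_singleton] at hq
    rcases hq with rfl | rfl
    · exact hv2 hmem'
    · exact hvl hmem'
  have hv'bad : v' ∈ ThetaData.badPrimesMod T.D := by
    have hVF : FinitePlace.mk x ∈ T.D.VFbad :=
      (T.isP5Choice (FinitePlace.mk x)).mpr (by rw [FinitePlace.maximalIdeal_mk]; exact ⟨hx2l, hmult⟩)
    have h1 := (ThetaData.mk_mem_VFbad_iff T.D x).mp hVF
    have he : HeightOneSpectrum.under (𝓞 ↥(fieldOfModuli T.E)) x = v' := HeightOneSpectrum.ext rfl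
    rwa [he] at h1
  -- `w'` is NOT a (P5)-bad prime: otherwise `y ∤ 2l` and `E_F` multiplicative at `y`, so `ord_w j(λ) < 0`, `w ∤ 2`, `w ∤ l`
  have hw'not : w' ∉ ThetaData.badPrimesMod T.D := by
    intro hbad
    have he : HeightOneSpectrum.under (𝓞 ↥(fieldOfModuli T.E)) y = w' := HeightOneSpectrum.ext rfl
    have hVF : FinitePlace.mk y ∈ T.D.VFbad := (ThetaData.mk_mem_VFbad_iff T.D y).mpr (by rw [he]; exact hbad)
    obtain ⟨hy2l, hmulty⟩ := (T.isP5Choice (FinitePlace.mk y)).mp hVF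
    rw [FinitePlace.maximalIdeal_mk] at hy2l hmulty
    have hordy : ord T.F y T.E.j < 0 := ThetaData.ord_j_neg_of_hasMultiplicativeReductionAt hmulty
    rcases hwj with hge | h2 | hl2
    · have h1 : ord Fm (finBelow Fm T.F y) (Cor22.jMod P) < 0 := by
        rw [← Cor22.ord_algebraMap_neg_iff y (Cor22.jMod P), hjj]
        exact hordy
      rw [hyw] at h1
      exact absurd h1 (not_lt.mpr hge)
    · exact hy2l 2 (by simp) ((Cor22.natCast_mem_asIdeal_finBelow_iff y 2).mp (by rw [hyw]; exact h2))
    · exact hy2l l (by simp) ((Cor22.natCast_mem_asIdeal_finBelow_iff y l).mp (by rw [hyw]; exact hl2))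
  -- the SHARP pair inequality at `(v', w')`, read on the DATUM's `F_mod(E_F)`
  have hS4 : weight ↥(fieldOfModuli T.E) v' * weight ↥(fieldOfModuli T.E) w' * ((l : ℝ) * ((l : ℝ) + 1) / 12) *
      (((-ord ↥(fieldOfModuli T.E) v' (ThetaData.jMod T.E) : ℤ) : ℝ) / (2 * (l : ℝ)) *
        logNorm ↥(fieldOfModuli T.E) v' / (localDegree ↥(fieldOfModuli T.E) v' : ℝ)) ≤
      δ - (((l : ℝ) + 5) / 4 - (Cor22.dmod P : ℝ)) * (P.logDiff + (1 - 1 / (l : ℝ)) * Cor22.logCondAvoid P {2, l}) :=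
    ordPair_le_slack_of_hullVolumeAtDatum h hl T hd4 p ⟨v', hv'p⟩ ⟨w', hw'p⟩ hv'bad hw'not
  -- transport the weights and the normalised local height to the POINT's `F_mod = ℚ(j(λ))`
  have hwv : weight ↥(fieldOfModuli T.E) v' = weight Fm v := by
    rw [← hxv]; exact (weight_finBelow_eq_of_range_eq hrange x hxp).symm
  have hww : weight ↥(fieldOfModuli T.E) w' = weight Fm w := by
    rw [← hyw]; exact (weight_finBelow_eq_of_range_eq hrange y hyp).symm
  have hμ : ((-ord ↥(fieldOfModuli T.E) v' (ThetaData.jMod T.E) : ℤ) : ℝ) / (2 * (l : ℝ)) *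
        logNorm ↥(fieldOfModuli T.E) v' / (localDegree ↥(fieldOfModuli T.E) v' : ℝ) =
      ((-ord Fm v (Cor22.jMod P) : ℤ) : ℝ) / (2 * (l : ℝ)) * logNorm Fm v / (localDegree Fm v : ℝ) := by
    have key := ord_mul_logNorm_div_localDegree_finBelow_eq (A := Fm) (B := ↥(fieldOfModuli T.E)) hjj x
    rw [hxv] at key
    have e : ∀ a L n : ℝ, -a / (2 * (l : ℝ)) * L / n = -(1 / (2 * (l : ℝ))) * (a * L / n) := fun _ _ _ => by ring
    push_cast
    rw [e, e, key]
  rw [hwv, hww, hμ] at hS4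
  exact hS4

/-- **The SHARP split-pair inequality read on the presenting field when `ℚ(j(λ)) = ℚ(λ)`** (sharp twin of abc-iut-s2-p3's
`splitPairPt_le_of_hullVolumeAtDatum`). For `P = (F_tpd, λ)` with `ℚ(j(λ)) = F_tpd`, places `V, W` of `F_tpd` over one rational
prime `p` with `ord_V j(λ) < 0`, `V ∤ 2`, `V ∤ l` and `0 ≤ ord_W j(λ)`: IF `Cor22.HullVolumeAtDatum P l δ`, `4·d_mod ≤ l + 5`, and a genuine
Θ-volume datum exists at `(P, l)`, THEN
`Pr(V)·Pr(W)·(l(l+1)/12)·((−ord_V j(λ))/(2l))·log N(V)/n_V ≤ δ − ((l+5)/4 − d_mod)·(log-diff(λ) + (1 − 1/l)·log 𝔣^{F_tpd}_{∤2l})`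
— `splitPair_le_slack_of_hullVolumeAtDatum` transported along the bijection of places (s2-p3's `finBelow_injective_of_adjoin_eq_top`,
`weight_finBelow_eq_of_adjoin_eq_top`, s2-p5's `ord_mul_logNorm_div_localDegree_algebraMap`). Nothing asserted about any point.
[cite: Mochizuki2012, IUTchIV Thm. 1.10 Step (v) p. 27–28] [cite: DupuyHilado2025, §3.3, §3.6, §4.7, §4.12]
[claim: Mochizuki2012, status: disputed] -/
theorem splitPairPt_le_slack_of_hullVolumeAtDatum {δ : ℝ} (h : Cor22.HullVolumeAtDatum P l δ) (hl : 0 < l)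
    (T : Cor22.ThetaVolumeDatumAt P l) (hd4 : 4 * (Cor22.dmod P : ℝ) ≤ (l : ℝ) + 5)
    (htop : IntermediateField.adjoin ℚ ({Cor22.jInv P.x} : Set P.F) = ⊤)
    (p : ℕ) [Fact p.Prime] (V W : HeightOneSpectrum (𝓞 P.F)) (hV : V ∈ placesOver P.F p) (hW : W ∈ placesOver P.F p)
    (hVj : ord P.F V (Cor22.jInv P.x) < 0) (hV2 : ((2 : ℕ) : 𝓞 P.F) ∉ V.asIdeal) (hVl : ((l : ℕ) : 𝓞 P.F) ∉ V.asIdeal)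
    (hWj : 0 ≤ ord P.F W (Cor22.jInv P.x)) :
    weight P.F V * weight P.F W * ((l : ℝ) * ((l : ℝ) + 1) / 12) *
      (((-ord P.F V (Cor22.jInv P.x) : ℤ) : ℝ) / (2 * (l : ℝ)) * logNorm P.F V / (localDegree P.F V : ℝ)) ≤
      δ - (((l : ℝ) + 5) / 4 - (Cor22.dmod P : ℝ)) * (P.logDiff + (1 - 1 / (l : ℝ)) * Cor22.logCondAvoid P {2, l}) := by
  -- adapted from abc-iut-s2-p3's `splitPairPt_le_of_hullVolumeAtDatum` (Conditional/AbcOfSHvolGenuineFamily.lean)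
  set Fm : Type := ↥(IntermediateField.adjoin ℚ ({Cor22.jInv P.x} : Set P.F)) with hFm
  set v := finBelow Fm P.F V with hv_def
  set w := finBelow Fm P.F W with hw_def
  have hv : v ∈ placesOver Fm p := finBelow_mem_placesOver Fm P.F hV
  have hw : w ∈ placesOver Fm p := finBelow_mem_placesOver Fm P.F hW
  have hj : algebraMap Fm P.F (Cor22.jMod P) = Cor22.jInv P.x := rfl
  have hvj : ord Fm v (Cor22.jMod P) < 0 := (Cor22.ord_algebraMap_neg_iff V (Cor22.jMod P)).mp (by rw [hj]; exact hVj)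
  have hv2 : ((2 : ℕ) : 𝓞 Fm) ∉ v.asIdeal := fun h2 => hV2 ((Cor22.natCast_mem_asIdeal_finBelow_iff V 2).mp h2)
  have hvl : ((l : ℕ) : 𝓞 Fm) ∉ v.asIdeal := fun h2 => hVl ((Cor22.natCast_mem_asIdeal_finBelow_iff V l).mp h2)
  have hwj : 0 ≤ ord Fm w (Cor22.jMod P) ∨ ((2 : ℕ) : 𝓞 Fm) ∈ w.asIdeal ∨ ((l : ℕ) : 𝓞 Fm) ∈ w.asIdeal := by
    refine Or.inl (not_lt.mp fun hlt => ?_)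
    have := (Cor22.ord_algebraMap_neg_iff W (Cor22.jMod P)).mpr hlt
    rw [hj] at this
    exact absurd this (not_lt.mpr hWj)
  have key := splitPair_le_slack_of_hullVolumeAtDatum h hl T hd4 p v w hv hw hvj hv2 hvl hwj
  rw [weight_finBelow_eq_of_adjoin_eq_top htop V hV, weight_finBelow_eq_of_adjoin_eq_top htop W hW] at key
  have hh : (ord P.F V (Cor22.jInv P.x) : ℝ) * logNorm P.F V / (localDegree P.F V : ℝ) =
      (ord Fm v (Cor22.jMod P) : ℝ) * logNorm Fm v / (localDegree Fm v : ℝ) :=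
    ord_mul_logNorm_div_localDegree_algebraMap V (Cor22.jMod P)
  have hterm : ((-ord P.F V (Cor22.jInv P.x) : ℤ) : ℝ) / (2 * (l : ℝ)) * logNorm P.F V / (localDegree P.F V : ℝ) =
      ((-ord Fm v (Cor22.jMod P) : ℤ) : ℝ) / (2 * (l : ℝ)) * logNorm Fm v / (localDegree Fm v : ℝ) := by
    push_cast
    calc -(ord P.F V (Cor22.jInv P.x) : ℝ) / (2 * (l : ℝ)) * logNorm P.F V / (localDegree P.F V : ℝ)
        = -(1 / (2 * (l : ℝ))) * ((ord P.F V (Cor22.jInv P.x) : ℝ) * logNorm P.F V / (localDegree P.F V : ℝ)) := by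
          ring
      _ = -(1 / (2 * (l : ℝ))) * ((ord Fm v (Cor22.jMod P) : ℝ) * logNorm Fm v / (localDegree Fm v : ℝ)) := by rw [hh]
      _ = -(ord Fm v (Cor22.jMod P) : ℝ) / (2 * (l : ℝ)) * logNorm Fm v / (localDegree Fm v : ℝ) := by ring
  rw [hterm]
  exact key

/-- **At a quadratic point of split depth `≥ 2M` the (U)-computable half forces
`(l+1)·M·log p/48 ≤ δ − ((l+5)/4 − 2)·(log-diff(λ) + (1 − 1/l)·log 𝔣^{F_tpd}_{∤2l}(λ))`** (sharp twin of abc-iut-s2-p3's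
`splitDepth_le_of_hullVolumeAtDatum`). For `P = (F, λ)` with `ℚ(j(λ)) = F`, `d_mod(P) = 2`, places `V, W` of `F` over the odd prime
`p` with `Pr(V) = Pr(W) = 1/2`, `n_V = 1`, `log N(V) = log p`, `ord_V j(λ) ≤ −2M` (`M ≥ 1`), `0 ≤ ord_W j(λ)`, `V ∤ 2`, `V ∤ l`
(`l ≥ 3`) — the shape of abc-iut-s2-p3's `SplitDepth.exists_point` and of abc-iut-s2-p5's `QuadWitness` family —
`Cor22.HullVolumeAtDatum P l δ` and a genuine datum give `(1/4)·(l(l+1)/12)·((−ord_V j)/(2l))·log p ≤ δ − ((l+5)/4 − 2)·(lD + (1−1/l)·lC)`.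
Nothing asserted about any point. [cite: Mochizuki2012, IUTchIV Thm. 1.10 Step (ii) p. 24, Step (v) p. 27–28]
[cite: DupuyHilado2025, §3.3, §3.6, §4.7] [claim: Mochizuki2012, status: disputed] -/
theorem splitDepth_le_slack_of_hullVolumeAtDatum {F : Type} [Field F] [NumberField F] {x : F} {δ : ℝ}
    (h : Cor22.HullVolumeAtDatum (NFPoint.mk F x) l δ) (T : Cor22.ThetaVolumeDatumAt (NFPoint.mk F x) l) (hl3 : 3 ≤ l)
    (htop : IntermediateField.adjoin ℚ ({Cor22.jInv x} : Set F) = ⊤) (hd2 : Cor22.dmod (NFPoint.mk F x) = 2)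
    {p : ℕ} [Fact p.Prime] {V W : HeightOneSpectrum (𝓞 F)} (hV : V ∈ placesOver F p) (hW : W ∈ placesOver F p)
    {M : ℕ} (hM : 1 ≤ M) (hVj : ord F V (Cor22.jInv x) ≤ -(2 * M : ℤ)) (hWj : 0 ≤ ord F W (Cor22.jInv x))
    (hV2 : ((2 : ℕ) : 𝓞 F) ∉ V.asIdeal) (hVl : ((l : ℕ) : 𝓞 F) ∉ V.asIdeal)
    (hwV : weight F V = 1 / 2) (hwW : weight F W = 1 / 2) (hnV : localDegree F V = 1) (hNV : logNorm F V = Real.log p) :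
    ((l : ℝ) + 1) * M * Real.log p / 48 ≤
      δ - (((l : ℝ) + 5) / 4 - 2) *
        ((NFPoint.mk F x).logDiff + (1 - 1 / (l : ℝ)) * Cor22.logCondAvoid (NFPoint.mk F x) {2, l}) := by
  -- adapted from abc-iut-s2-p3's `splitDepth_le_of_hullVolumeAtDatum` (Conditional/AbcOfSHvolGenuineFamily.lean)
  have hl : 0 < l := by omega
  have hd4 : 4 * (Cor22.dmod (NFPoint.mk F x) : ℝ) ≤ (l : ℝ) + 5 := by
    rw [hd2]
    have : (3 : ℝ) ≤ l := by exact_mod_cast hl3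
    push_cast; linarith
  have key := splitPairPt_le_slack_of_hullVolumeAtDatum (P := NFPoint.mk F x) h hl T hd4 htop p V W hV hW
    (by show ord F V (Cor22.jInv x) < 0; omega) hV2 hVl hWj
  change weight F V * weight F W * ((l : ℝ) * ((l : ℝ) + 1) / 12) *
      (((-ord F V (Cor22.jInv x) : ℤ) : ℝ) / (2 * (l : ℝ)) * logNorm F V / (localDegree F V : ℝ)) ≤
      δ - (((l : ℝ) + 5) / 4 - (Cor22.dmod (NFPoint.mk F x) : ℝ)) *
        ((NFPoint.mk F x).logDiff + (1 - 1 / (l : ℝ)) * Cor22.logCondAvoid (NFPoint.mk F x) {2, l}) at key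
  rw [hwV, hwW, hnV, hNV, hd2] at key
  push_cast at key
  have hl0 : (0 : ℝ) < l := by exact_mod_cast hl
  have hlogp : 0 < Real.log p := Real.log_pos (by exact_mod_cast (Fact.out : p.Prime).one_lt)
  have hM' : (2 * M : ℝ) ≤ -(ord F V (Cor22.jInv x) : ℝ) := by
    have : (2 * M : ℤ) ≤ -ord F V (Cor22.jInv x) := by omega
    exact_mod_cast this
  have e1 : ((l : ℝ) + 1) * M * Real.log p / 48 =
      1 / 2 * (1 / 2) * ((l : ℝ) * ((l : ℝ) + 1) / 12) * ((2 * M : ℝ) / (2 * (l : ℝ)) * Real.log p / 1) := by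
    field_simp
    ring
  rw [e1]
  refine le_trans ?_ key
  have hc : 0 ≤ 1 / 2 * (1 / 2) * ((l : ℝ) * ((l : ℝ) + 1) / 12) := by positivity
  refine mul_le_mul_of_nonneg_left ?_ hc
  rw [div_one, div_one]
  exact mul_le_mul_of_nonneg_right (div_le_div_of_nonneg_right hM' (by positivity)) hlogp.le

end PointDict

end Summit.ABC.IUTFork

end
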